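import Mathlib
import Summits.Ventures.HodgeRepro.Tier4.Common.ConcreteWitness
import Summits.Ventures.HodgeRepro.Tier4.Common.TargetJacobian

/-!
# Tier4/Common/HeckeRegularity — (T3) DISCHARGED and (T0) REDUCED: Hecke translates of holomorphic forms are
holomorphic, and holomorphic forms are bounded on a relatively compact domain

Blind re-derivation cell `pub-hodge-repro`, Tier 4 (README §9–§10), seat t4-typer-1 (gen 0).  Target tree path
`lean/Summits/Ventures/HodgeRepro/Tier4/Common/HeckeRegularity.lean`.  Imports `ConcreteWitness` (typer-1: the
residuals `IsHeckeGoodOn`, `IsCornerGoodOn`) and typer-2's `TargetJacobian` (`pd_actM`: the explicit rational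
formula for the partials of the ball action, `mulVec_lift3_two_ne_zero`).

WHAT IS PROVED.  The entries of the Jacobian matrix of the ball action `actM M`, `M ∈ U(2,1)`, are holomorphic on
the ball (`differentiableOn_jacMat_actM`: rational functions with the non-vanishing denominator `(M(z,1))₂`), so
the pull-backs `pullField (act γ) G`, `pullCoeff (act γ) h` of holomorphic forms are holomorphic
(`isHolo1_pullField_act`, `isHolo2_pullCoeff_act`), and so are the Hecke sums and translates
(`isHolo1_heckeField`, `isHolo2_heckeCoeff`).  A function continuous on the ball is bounded measurable on a
RELATIVELY COMPACT measurable `D` (`closure D ⊆ ball`: `isBddMeasOn_of_continuousOn`).  Hence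
**`isHeckeGoodOn_of`**: (T3) holds for every relatively compact measurable `D` — a THEOREM, no residual; and
**`isCornerGoodOn_of`**: (T0) reduces to the single statement «the corner fields are holomorphic on the ball»
(`IsHolo1 (cornerField i σ hσ)` — the Osgood regularity of the gradient of a ℂ-differentiable map of two variables,
the one fact Mathlib lacks, see AutForms).

Nothing here says anything about the status of the Hodge conjecture for CM abelian varieties, which is NOT proved
(HC_CM is NOT proved by anyone in this repository).
-/

set_option autoImplicit false

noncomputable section

open Matrix MeasureTheory NumberField Set
open scoped ComplexConjugate ComplexOrder

namespace Summit.Ventures.HodgeRepro.Tier4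

/-! ## Holomorphy of the Jacobian of the ball action -/

section Jacobian

variable {M : Matrix (Fin 3) (Fin 3) ℂ}

/-- The affine coordinate `z ↦ (M (z,1))ᵢ` is differentiable. -/
theorem differentiable_affine (i : Fin 3) : Differentiable ℂ fun w : Fin 2 → ℂ => (M *ᵥ lift3 w) i :=
  differentiable_mulVec_lift3 M i

/-- The entries of the Jacobian matrix of the ball action are holomorphic on the ball (`M ∈ U(2,1)`). -/
theorem differentiableOn_jacMat_actM (hM : Mᴴ * J * M = J) (i k : Fin 2) :
    DifferentiableOn ℂ (fun z => jacMat (actM M) z i k) ball := by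
  have e : ∀ z ∈ ball, jacMat (actM M) z i k =
      (M (Fin.castSucc i) (Fin.castSucc k) * (M *ᵥ lift3 z) 2 -
        (M *ᵥ lift3 z) (Fin.castSucc i) * M 2 (Fin.castSucc k)) * (((M *ᵥ lift3 z) 2) ^ 2)⁻¹ := fun z hz => by
    rw [← div_eq_mul_inv]
    exact pd_actM M z (mulVec_lift3_two_ne_zero hM hz) i k
  refine DifferentiableOn.congr ?_ e
  have hnum : DifferentiableOn ℂ (fun z => M (Fin.castSucc i) (Fin.castSucc k) * (M *ᵥ lift3 z) 2 -
      (M *ᵥ lift3 z) (Fin.castSucc i) * M 2 (Fin.castSucc k)) ball :=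
    (((differentiable_affine (M := M) 2).const_mul _).sub
      ((differentiable_affine (M := M) _).mul_const _)).differentiableOn
  have hden : DifferentiableOn ℂ (fun z => ((M *ᵥ lift3 z) 2) ^ 2) ball :=
    ((differentiable_affine (M := M) 2).pow 2).differentiableOn
  exact hnum.mul (hden.inv fun z hz => pow_ne_zero 2 (mulVec_lift3_two_ne_zero hM hz))

/-- The Jacobian determinant of the ball action is holomorphic on the ball (`M ∈ U(2,1)`). -/
theorem differentiableOn_jacDetMap_actM (hM : Mᴴ * J * M = J) :
    DifferentiableOn ℂ (fun z => jacDetMap (actM M) z) ball := by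
  have e : ∀ z ∈ ball, jacDetMap (actM M) z = M.det * (((M *ᵥ lift3 z) 2) ^ 3)⁻¹ := fun z hz => by
    rw [← div_eq_mul_inv]
    exact jacDetMap_actM M z (mulVec_lift3_two_ne_zero hM hz)
  refine DifferentiableOn.congr ?_ e
  have hden : DifferentiableOn ℂ (fun z => ((M *ᵥ lift3 z) 2) ^ 3) ball :=
    ((differentiable_affine (M := M) 2).pow 3).differentiableOn
  exact (differentiableOn_const _).mul (hden.inv fun z hz => pow_ne_zero 3 (mulVec_lift3_two_ne_zero hM hz))

end Jacobian

namespace TargetData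

variable {F E : Type} [Field F] [NumberField F] [IsGalois ℚ F] [IsCMField F]
  [Field E] [NumberField E] [IsGalois ℚ E] [IsCMField E] (d : TargetData F E)

/-- The pull-back of a holomorphic cotangent field along the action of an `H`-unitary matrix is holomorphic on the
ball. -/
theorem isHolo1_pullField_act {γ : Matrix (Fin 3) (Fin 3) E} (hγ : IsUnitaryOf (conjE E) d.H γ)
    {G : (Fin 2 → ℂ) → (Fin 2 → ℂ)} (hG : IsHolo1 G) : IsHolo1 (pullField (d.act γ) G) := by
  have hM := d.toBallMat_mem_U21_of_unitary hγ
  have hG' : DifferentiableOn ℂ G ball := hG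
  have hcomp : DifferentiableOn ℂ (fun z => G (d.act γ z)) ball :=
    hG'.comp (d.differentiableOn_act_of_unitary hγ) fun z hz => d.act_mem_ball_of_unitary hγ hz
  refine differentiableOn_pi.2 fun k => ?_
  have e : (fun z => pullField (d.act γ) G z k) =
      fun z => ∑ j, jacMat (d.act γ) z j k * G (d.act γ z) j := by
    funext z
    simp [pullField, Matrix.mulVec, dotProduct, Matrix.transpose_apply]
  rw [e]
  exact DifferentiableOn.fun_sum fun j _ => (differentiableOn_jacMat_actM hM j k).mul ((differentiableOn_pi.1 hcomp) j)

/-- The `2`-form pull-back of a holomorphic coefficient along the action of an `H`-unitary matrix is holomorphic. -/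
theorem isHolo2_pullCoeff_act {γ : Matrix (Fin 3) (Fin 3) E} (hγ : IsUnitaryOf (conjE E) d.H γ)
    {h : (Fin 2 → ℂ) → ℂ} (hh : IsHolo2 h) : IsHolo2 (pullCoeff (d.act γ) h) := by
  have hM := d.toBallMat_mem_U21_of_unitary hγ
  have hh' : DifferentiableOn ℂ h ball := hh
  have hcomp : DifferentiableOn ℂ (fun z => h (d.act γ z)) ball :=
    hh'.comp (d.differentiableOn_act_of_unitary hγ) fun z hz => d.act_mem_ball_of_unitary hγ hz
  exact hcomp.mul (differentiableOn_jacDetMap_actM hM)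

/-- The Hecke sum of a holomorphic cotangent field is holomorphic on the ball (all representatives unitary). -/
theorem isHolo1_heckeSum (ts : List (ℤ × Finset (Matrix (Fin 3) (Fin 3) E)))
    (hts : ∀ t ∈ ts, ∀ r ∈ t.2, IsUnitaryOf (conjE E) d.H r) {G : (Fin 2 → ℂ) → (Fin 2 → ℂ)} (hG : IsHolo1 G) :
    IsHolo1 (d.heckeSum ⟨ts⟩ G) := by
  induction ts with
  | nil =>
    have h0 : d.heckeSum ⟨[]⟩ G = fun _ => 0 := by
      funext z
      simp [heckeSum]
    rw [h0]
    exact differentiableOn_const 0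
  | cons t ts ih =>
    rw [d.heckeSum_cons_fun]
    have h1 : DifferentiableOn ℂ (fun w => ∑ r ∈ t.2, pullField (d.act r) G w) ball := by
      exact DifferentiableOn.fun_sum fun r hr => d.isHolo1_pullField_act (hts t List.mem_cons_self r hr) hG
    have h2 := ih fun t' ht' => hts t' (List.mem_cons_of_mem _ ht')
    refine DifferentiableOn.add ?_ h2
    rw [← Int.cast_smul_eq_zsmul ℂ]
    exact h1.const_smul _

/-- The Hecke sum of a holomorphic `2`-form coefficient is holomorphic on the ball (all representatives unitary). -/
theorem isHolo2_heckeCoeffSum (ts : List (ℤ × Finset (Matrix (Fin 3) (Fin 3) E)))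
    (hts : ∀ t ∈ ts, ∀ r ∈ t.2, IsUnitaryOf (conjE E) d.H r) {h : (Fin 2 → ℂ) → ℂ} (hh : IsHolo2 h) :
    IsHolo2 (d.heckeCoeffSum ⟨ts⟩ h) := by
  induction ts with
  | nil =>
    have h0 : d.heckeCoeffSum ⟨[]⟩ h = fun _ => 0 := by
      funext z
      simp [heckeCoeffSum]
    rw [h0]
    exact differentiableOn_const 0
  | cons t ts ih =>
    rw [d.heckeCoeffSum_cons_fun]
    have h1 : DifferentiableOn ℂ (fun w => ∑ r ∈ t.2, pullCoeff (d.act r) h w) ball := by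
      exact DifferentiableOn.fun_sum fun r hr => d.isHolo2_pullCoeff_act (hts t List.mem_cons_self r hr) hh
    have h2 := ih fun t' ht' => hts t' (List.mem_cons_of_mem _ ht')
    refine DifferentiableOn.add ?_ h2
    rw [← Int.cast_smul_eq_zsmul ℂ]
    exact h1.const_smul _

/-- The Hecke translate of a holomorphic `1`-form is holomorphic on the ball. -/
theorem isHolo1_heckeField {Γ' : Set (Matrix (Fin 3) (Fin 3) E)} (hΓ' : d.IsLevel Γ') {h : HeckeElement E}
    (hh : h.IsFor (conjE E) d.H Γ') {G : (Fin 2 → ℂ) → (Fin 2 → ℂ)} (hG : IsHolo1 G) : IsHolo1 (d.heckeField h G) := by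
  have hunit : ∀ t ∈ h.terms, ∀ r ∈ t.2, IsUnitaryOf (conjE E) d.H r := fun t ht r hr =>
    d.isUnitaryOf_of_mem_reps hΓ'.subset hh ht hr
  obtain ⟨ts⟩ := h
  exact (d.isHolo1_heckeSum ts hunit hG).congr fun z hz => d.heckeField_of_mem _ _ hz

/-- The Hecke translate of a holomorphic `2`-form coefficient is holomorphic on the ball. -/
theorem isHolo2_heckeCoeff {Γ' : Set (Matrix (Fin 3) (Fin 3) E)} (hΓ' : d.IsLevel Γ') {h : HeckeElement E}
    (hh : h.IsFor (conjE E) d.H Γ') {k : (Fin 2 → ℂ) → ℂ} (hk : IsHolo2 k) : IsHolo2 (d.heckeCoeff h k) := by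
  have hunit : ∀ t ∈ h.terms, ∀ r ∈ t.2, IsUnitaryOf (conjE E) d.H r := fun t ht r hr =>
    d.isUnitaryOf_of_mem_reps hΓ'.subset hh ht hr
  obtain ⟨ts⟩ := h
  exact (d.isHolo2_heckeCoeffSum ts hunit hk).congr fun z hz => d.heckeCoeff_of_mem _ _ hz

end TargetData

/-! ## Boundedness on a relatively compact domain -/

/-- A relatively compact subset of the ball has compact closure. -/
theorem isCompact_closure_of_subset_ball {D : Set (Fin 2 → ℂ)} (hD : closure D ⊆ ball) : IsCompact (closure D) :=
  Metric.isCompact_of_isClosed_isBounded isClosed_closure (isBounded_ball.subset hD)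

/-- A function continuous on the ball is bounded measurable on a relatively compact measurable `D ⊆ 𝔹²`. -/
theorem isBddMeasOn_of_continuousOn {β : Type} [NormedAddCommGroup β] {D : Set (Fin 2 → ℂ)} (hD : closure D ⊆ ball)
    (hDm : MeasurableSet D) {f : (Fin 2 → ℂ) → β} (hf : ContinuousOn f ball) : IsBddMeasOn D f := by
  refine ⟨(hf.mono (subset_closure.trans hD)).aestronglyMeasurable hDm, ?_⟩
  obtain ⟨C, hC⟩ := (isCompact_closure_of_subset_ball hD).exists_bound_of_continuousOn (hf.mono hD)
  exact ⟨C, fun z hz => hC z (subset_closure hz)⟩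

namespace TargetData

variable {F E : Type} [Field F] [NumberField F] [IsGalois ℚ F] [IsCMField F]
  [Field E] [NumberField E] [IsGalois ℚ E] [IsCMField E] (d : TargetData F E)

/-- **(T3) HOLDS on a relatively compact domain**: the Hecke translates of holomorphic concrete forms are holomorphic
concrete forms, for every measurable `D` with `closure D ⊆ 𝔹²`. -/
theorem isHeckeGoodOn_of {Γ' : Set (Matrix (Fin 3) (Fin 3) E)} (hΓ' : d.IsLevel Γ') {D : Set (Fin 2 → ℂ)}
    (hD : closure D ⊆ ball) (hDm : MeasurableSet D) : d.IsHeckeGoodOn Γ' D := by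
  intro h hh x hx
  have h1 : IsHolo1 (d.heckeField h x.1) := d.isHolo1_heckeField hΓ' hh hx.2.1
  have h2 : IsHolo2 (d.heckeCoeff h x.2) := d.isHolo2_heckeCoeff hΓ' hh hx.2.2
  exact ⟨⟨isBddMeasOn_of_continuousOn hD hDm h1.continuousOn, isBddMeasOn_of_continuousOn hD hDm h2.continuousOn⟩,
    h1, h2⟩

/-- **(T0) REDUCED to holomorphy**: on a relatively compact measurable domain, the corner fields are bounded
measurable as soon as they are holomorphic on the ball. -/
theorem isCornerGoodOn_of {D : Set (Fin 2 → ℂ)} (hD : closure D ⊆ ball) (hDm : MeasurableSet D)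
    (hholo : ∀ (i : Fin 4) (σ : F →+* ℂ) (hσ : σ ∈ d.T i), IsHolo1 (d.cornerField i σ hσ)) :
    d.IsCornerGoodOn D := fun i σ hσ =>
  ⟨isBddMeasOn_of_continuousOn hD hDm (hholo i σ hσ).continuousOn, hholo i σ hσ⟩

end TargetData

end Summit.Ventures.HodgeRepro.Tier4
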